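import Summits.ResolutionOfSingularities.ResolutionOfSingularities.Theorems.RadicialJungCleanModelsCcurveUnitDichotomy
import Summits.ResolutionOfSingularities.ResolutionOfSingularities.Theorems.RadicialJungCleanModelsCcurveUnitDefectless
import Summits.ResolutionOfSingularities.ResolutionOfSingularities.Theorems.RadicialJungCleanModelsCcurvePointPrepInside
import Summits.ResolutionOfSingularities.ResolutionOfSingularities.Theorems.RadicialJungCleanModelsCcurvePersistUpstairs
import HarnessLib

/-!
# Route `RadicialJung`, crux `CleanModels` (stmt-15917) — (C-curve) sub-line over ARBITRARY ground fields: the unit case `persistForm2` WITHOUT `PerfectField k`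

Lead `res-B-lead-1` g7 (towards Sketch rev 30).  OURS · counted 0.  Nothing here proves resolution in characteristic `p`; resolution in char `p` is NOT proved.

`persistForm2_gen_of (hS3)`: the statement of the workfile stub `stub_Cc_persistForm2` with the binder `[PerfectField k]` REMOVED, from the shared node S3
(`stub_Cc_centreCurve`, closed by ✓ `centreCurve_of` ∘ ✓ `curveRegularize`).  The `p`-degree argument of ✓ `persistForm2_of` (which needs `[κ(C):κ(C)^p] = p`,
i.e. a perfect ground field) is replaced by valuation theory on the residue field `L = κ(R₁)` of the local ring `R₁` at the centre curve: the residue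
valuation ring `V̄` of `O` is a DEFECTLESS valued field (✓ `isDefectlessField_residueVal`: Kuhlmann), so the residue `w̄ ∉ L^p` of the unit representative has a
BEST `p`-th-power approximation `f₀` (✓ `exists_isMin_pthPowerApprox_of_isDefectlessField`), which lifts to `c₀ ∈ S′` (`exists_mem_residue_eq`:
`V̄ ⊆` image of `S′`); `w − c₀^p = U z^m + x α + y β` and (✓ `dichotomy_of_best_approx`) either `p ∤ m` — then `m + 1` point blow-ups give FORM (1) as in
✓ `persistForm2_of` — or the residue of `U` is not a `p`-th power — then after the point blow-ups (which stay inside `R₁`, ✓ `pointPrep_weak_le`) and the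
`K^p`-rescaling by `z^{-m}` the representative is a unit with non-`p`-th-power residue: FORM (2).
-/

noncomputable section

set_option linter.dupNamespace false

open IsLocalRing Literature.AlgebraicGeometry.Resolution
open Summit.ResolutionOfSingularities.ResolutionOfSingularities.Theorems
open Summit.ResolutionOfSingularities.ResolutionOfSingularities.Theorems.SwitchingDichotomy

namespace Summit.ResolutionOfSingularities.ResolutionOfSingularities.Theorems.RadicialJung.CleanModels.Ccurve

variable {K : Type} [Field K]

/-- The value of `U z^e + x α + y β` is the value of `z^e` when `U` is an `O`-unit and `x, y` are infinitely deeper than `z` along `O ≤ O₁`. [folklore] -/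
theorem valuation_unit_mul_pow_add {O O₁ : ValuationSubring K} (hOO₁ : O ≤ O₁) {U z x y α β : K} (hU : O.valuation U = 1)
    (hz : O₁.valuation z = 1) (hx : O₁.valuation x < 1) (hy : O₁.valuation y < 1) (hα : α ∈ O) (hβ : β ∈ O) (e : ℕ) :
    O.valuation (U * z ^ e + x * α + y * β) = O.valuation (z ^ e) := by
  have hsmall : ∀ {w γ : K}, O₁.valuation w < 1 → γ ∈ O → O.valuation (w * γ) < O.valuation (z ^ e) := by
    intro w γ hw hγ
    have h1 : O.valuation w < O.valuation (z ^ e) :=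
      valuation_lt_of_lt_of_le hOO₁ (by rw [map_pow, hz, one_pow]; exact hw)
    calc O.valuation (w * γ) = O.valuation w * O.valuation γ := map_mul _ _ _
      _ ≤ O.valuation w * 1 := by gcongr; exact (O.valuation_le_one_iff _).mpr hγ
      _ < O.valuation (z ^ e) := by rw [mul_one]; exact h1
  have hUz : O.valuation (U * z ^ e) = O.valuation (z ^ e) := by rw [map_mul, hU, one_mul]
  rw [add_assoc, Valuation.map_add_eq_of_lt_left _ ?_, hUz]
  rw [hUz]
  exact lt_of_le_of_lt (Valuation.map_add _ _ _) (max_lt (hsmall hx hα) (hsmall hy hβ))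

/-- **`V̄ ⊆` image of `S′`**: every element of `R₁ = locAtCentre B′ O₁` lying in `O` is congruent modulo `𝔪_{R₁}` to an element of `S′ = locAtCentre B′ O`
(the centre curve is regular at the centre of `O`: `(x, y)` cut it out). [folklore] -/
theorem exists_mem_residue_eq {B' : Subring K} {O O₁ : ValuationSubring K} (hB'O : B' ≤ O.toSubring) (hOO₁ : O ≤ O₁)
    [IsRegularLocalRing ↥(locAtCentre B' O)] (hdim : ringKrullDim ↥(locAtCentre B' O) = 3)
    {x y z : K} (hx : x ∈ locAtCentre B' O) (hy : y ∈ locAtCentre B' O) (hz : z ∈ locAtCentre B' O)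
    (hmax : (haveI := isLocalRing_locAtCentre hB'O; IsLocalRing.maximalIdeal (locAtCentre B' O)) = Ideal.span {⟨x, hx⟩, ⟨y, hy⟩, ⟨z, hz⟩})
    (hcen : ∀ w : ↥(locAtCentre B' O), O₁.valuation (w : K) < 1 ↔ w ∈ Ideal.span ({⟨x, hx⟩, ⟨y, hy⟩} : Set ↥(locAtCentre B' O)))
    {r : K} (hr : r ∈ locAtCentre B' O₁) (hrO : r ∈ O) :
    ∃ c : K, c ∈ locAtCentre B' O ∧ O₁.valuation (c - r) < 1 := by
  haveI := isLocalRing_locAtCentre hB'O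
  have hB'O₁ : B' ≤ O₁.toSubring := fun w hw => hOO₁ (hB'O hw)
  obtain ⟨hvz₁, hvx₁, hvy₁⟩ := valuation_coarse_z_eq_one hB'O hOO₁ hdim hx hy hz hmax hcen
  have hz0 : z ≠ 0 := ne_zero_of_valuation_eq_one hvz₁
  have hvzlt : O.valuation z < 1 := (valuation_lt_one_of_gen hB'O hx hy hz hmax).2.2
  obtain ⟨a₀, ha₀, b₀, hb₀, hvb₀, rfl⟩ := mem_locAtCentre_iff.mp hr
  have hb₀0 : b₀ ≠ 0 := ne_zero_of_valuation_eq_one hvb₀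
  have ha₀S : a₀ ∈ locAtCentre B' O := le_locAtCentre _ _ ha₀
  have hb₀S : b₀ ∈ locAtCentre B' O := le_locAtCentre _ _ hb₀
  -- `b₀ = U z^e + x α + y β`
  obtain ⟨e, U, α, β, hU, hα, hβ, hvU, hb₀eq⟩ := exists_eq_unit_mul_pow_add_K hB'O hOO₁ hdim hx hy hz hmax hcen hb₀S hvb₀
  have hU0 : U ≠ 0 := ne_zero_of_valuation_eq_one hvU
  have hsmall₁ : ∀ {w γ : K}, O₁.valuation w < 1 → γ ∈ locAtCentre B' O → O₁.valuation (w * γ) < 1 := fun hw hγ =>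
    valuation_mul_lt_one_of_lt_of_mem O₁ hw (hB'O₁.trans le_rfl |> fun h => hOO₁ (locAtCentre_le hB'O hγ))
  by_cases hva₀ : O₁.valuation a₀ = 1
  · obtain ⟨e', U', α', β', hU', hα', hβ', hvU', ha₀eq⟩ := exists_eq_unit_mul_pow_add_K hB'O hOO₁ hdim hx hy hz hmax hcen ha₀S hva₀
    -- `e ≤ e'` since `a₀ / b₀ ∈ O`
    have hva : O.valuation a₀ = O.valuation (z ^ e') := by
      rw [ha₀eq]; exact valuation_unit_mul_pow_add hOO₁ hvU' hvz₁ hvx₁ hvy₁ (locAtCentre_le hB'O hα') (locAtCentre_le hB'O hβ') e'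
    have hvb : O.valuation b₀ = O.valuation (z ^ e) := by
      rw [hb₀eq]; exact valuation_unit_mul_pow_add hOO₁ hvU hvz₁ hvx₁ hvy₁ (locAtCentre_le hB'O hα) (locAtCentre_le hB'O hβ) e
    have hee' : e ≤ e' := by
      have h1 : O.valuation (a₀ / b₀) ≤ 1 := (O.valuation_le_one_iff _).mpr hrO
      rw [map_div₀, hva, hvb, div_le_one₀ ((Valuation.pos_iff _).mpr (pow_ne_zero _ hz0)), map_pow, map_pow] at h1
      exact (pow_le_pow_iff_right_of_lt_one₀ ((Valuation.pos_iff _).mpr hz0) hvzlt).mp h1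
    refine ⟨U' * U⁻¹ * z ^ (e' - e), Subring.mul_mem _ (Subring.mul_mem _ hU' (inv_mem_locAtCentre hU hvU)) (Subring.pow_mem _ hz _), ?_⟩
    have hnum : U' * U⁻¹ * z ^ (e' - e) - a₀ / b₀ =
        (U' * z ^ (e' - e) * (x * α + y * β) - U * (x * α' + y * β')) / (U * b₀) := by
      rw [eq_div_iff (mul_ne_zero hU0 hb₀0)]
      have hz' : z ^ e' = z ^ (e' - e) * z ^ e := by rw [← pow_add, Nat.sub_add_cancel hee']
      rw [div_eq_mul_inv]
      field_simp
      rw [hb₀eq, ha₀eq, hz']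
      ring
    rw [hnum, map_div₀, map_mul, Shannon.valuation_eq_one_of_le hOO₁ hvU, hvb₀, one_mul, div_one]
    refine lt_of_le_of_lt (Valuation.map_sub _ _ _) (max_lt ?_ ?_)
    · rw [mul_comm]
      refine valuation_mul_lt_one_of_lt_of_mem O₁ ?_ (hOO₁ (locAtCentre_le hB'O (Subring.mul_mem _ hU' (Subring.pow_mem _ hz _))))
      exact lt_of_le_of_lt (Valuation.map_add _ _ _) (max_lt (hsmall₁ hvx₁ hα) (hsmall₁ hvy₁ hβ))
    · rw [mul_comm]
      refine valuation_mul_lt_one_of_lt_of_mem O₁ ?_ (hOO₁ (locAtCentre_le hB'O hU))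
      exact lt_of_le_of_lt (Valuation.map_add _ _ _) (max_lt (hsmall₁ hvx₁ hα') (hsmall₁ hvy₁ hβ'))
  · -- `v₁ a₀ < 1`: the residue of `r` is `0`
    have hva₀' : O₁.valuation a₀ < 1 := lt_of_le_of_ne ((O₁.valuation_le_one_iff _).mpr (hB'O₁ ha₀)) hva₀
    refine ⟨0, Subring.zero_mem _, ?_⟩
    rw [zero_sub, Valuation.map_neg, map_div₀, hvb₀, div_one]; exact hva₀'

/-- **`stub_Cc_persistForm2` WITHOUT `[PerfectField k]`, modulo the shared node `stub_Cc_centreCurve` (S3)** — see the module docstring. [folklore] -/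
theorem persistForm2_gen_of
    (hS3 :
    ∀ (k : Type) [Field k] (K : Type) [Field K] [Algebra k K]
    (O : ValuationSubring K) (A : Subalgebra k K), A.toSubring ≤ O.toSubring → A.FG → IsFractionRing A K → ringKrullDim A ≤ 3 →
    (∀ (T : Subring K) (hT : T ≤ O.toSubring), A.toSubring ≤ T → (subringCentre T O hT).IsMaximal) →
    ∀ (B : Subalgebra k K) (hBO : B.toSubring ≤ O.toSubring), A ≤ B → B.FG →
    IsRegularLocalRing (locAtCentre B.toSubring O) → ringKrullDim (locAtCentre B.toSubring O) = 3 →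
    ∀ (O₁ : ValuationSubring K), O ≤ O₁ → ringKrullDim (locAtCentre B.toSubring O₁) = 2 →
    ∃ (B' : Subalgebra k K) (hB'O : B'.toSubring ≤ O.toSubring), B ≤ B' ∧ B'.FG ∧
    IsRegularLocalRing (locAtCentre B'.toSubring O) ∧ ringKrullDim (locAtCentre B'.toSubring O) = 3 ∧
    locAtCentre B'.toSubring O₁ = locAtCentre B.toSubring O₁ ∧
    ∃ (x y z : K) (hx : x ∈ locAtCentre B'.toSubring O) (hy : y ∈ locAtCentre B'.toSubring O) (hz : z ∈ locAtCentre B'.toSubring O),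
      (haveI := isLocalRing_locAtCentre hB'O; IsLocalRing.maximalIdeal (locAtCentre B'.toSubring O)) =
        Ideal.span {⟨x, hx⟩, ⟨y, hy⟩, ⟨z, hz⟩} ∧
      ∀ w : ↥(locAtCentre B'.toSubring O), O₁.valuation (w : K) < 1 ↔ w ∈ Ideal.span {(⟨x, hx⟩ : ↥(locAtCentre B'.toSubring O)), ⟨y, hy⟩} )
    :
    ∀ (p : ℕ), p.Prime →
    ∀ (k : Type) [Field k] [CharP k p] (K : Type) [Field K] [Algebra k K]
    (O : ValuationSubring K) (A : Subalgebra k K), A.toSubring ≤ O.toSubring → A.FG → IsFractionRing A K →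
    ringKrullDim A ≤ 3 → IsRegularLocalRing (locAtCentre A.toSubring O) →
    ringKrullDim (locAtCentre A.toSubring O) = 3 →
    (∀ (T : Subring K) (hT : T ≤ O.toSubring), A.toSubring ≤ T → (subringCentre T O hT).IsMaximal) →
    ∀ g₀ : K, (∀ c : K, c ^ p ≠ g₀) →
    ¬ (∃ (O₁ : ValuationSubring K), O ≤ O₁ ∧ O₁ ≠ ⊤ ∧ ∃ y : Fin 2 → K, (∀ i, y i ∈ O) ∧
      ∀ P : MvPolynomial (Fin 2) k, P ≠ 0 → O₁.valuation (MvPolynomial.aeval y P) = 1) →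
    ∀ (O₁ : ValuationSubring K), O ≤ O₁ → O₁ ≠ O → O₁ ≠ ⊤ →
    ∀ (B : Subalgebra k K), B.toSubring ≤ O.toSubring → A ≤ B → B.FG →
    IsRegularLocalRing (locAtCentre B.toSubring O) → ringKrullDim (locAtCentre B.toSubring O) = 3 →
    ringKrullDim ↥(locAtCentre B.toSubring O₁) = 2 →
    ∀ (_ : IsRegularLocalRing ↥(locAtCentre B.toSubring O₁)) (c : Fin p → K), (∃ j : Fin p, (j : ℕ) ≠ 0 ∧ c j ≠ 0) →
    (∃ u : ↥(locAtCentre B.toSubring O₁), IsUnit u ∧ (∑ j : Fin p, c j ^ p * g₀ ^ (j : ℕ)) = (u : K) ∧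
    ∀ c' : ↥(locAtCentre B.toSubring O₁), u - c' ^ p ∉ IsLocalRing.maximalIdeal ↥(locAtCentre B.toSubring O₁)) →
    ∃ (A' : Subalgebra k K), A'.toSubring ≤ O.toSubring ∧ A ≤ A' ∧ A'.FG ∧
    ∃ (_ : IsRegularLocalRing ↥(locAtCentre A'.toSubring O)) (c : Fin p → K), (∃ j : Fin p, (j : ℕ) ≠ 0 ∧ c j ≠ 0) ∧
    ((∃ (d m : ℕ) (hmd : m ≤ d) (t : Fin d → ↥(locAtCentre A'.toSubring O)) (a : Fin m → ℕ) (u : ↥(locAtCentre A'.toSubring O)), IsUnit u ∧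
    Ideal.span (Set.range t) = IsLocalRing.maximalIdeal ↥(locAtCentre A'.toSubring O) ∧
    ringKrullDim ↥(locAtCentre A'.toSubring O) = (d : WithBot ℕ∞) ∧ 0 < m ∧ (∀ i, ¬ p ∣ a i) ∧
    (∑ j : Fin p, c j ^ p * g₀ ^ (j : ℕ)) = (u : K) * ∏ i : Fin m, ((t (Fin.castLE hmd i) : ↥(locAtCentre A'.toSubring O)) : K) ^ (a i)) ∨
    (∃ u : ↥(locAtCentre A'.toSubring O), IsUnit u ∧ (∑ j : Fin p, c j ^ p * g₀ ^ (j : ℕ)) = (u : K) ∧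
    ∀ c' : ↥(locAtCentre A'.toSubring O), u - c' ^ p ∉ IsLocalRing.maximalIdeal ↥(locAtCentre A'.toSubring O)) ∨
    (∃ s c' : ↥(locAtCentre A'.toSubring O), (∑ j : Fin p, c j ^ p * g₀ ^ (j : ℕ)) = (s : K) ∧
    s - c' ^ p ∈ IsLocalRing.maximalIdeal ↥(locAtCentre A'.toSubring O) ∧
    s - c' ^ p ∉ IsLocalRing.maximalIdeal ↥(locAtCentre A'.toSubring O) ^ 2)) := by
  intro p hp k _ _ K _ _ O A hAO hAfg hfrac hdimA hreg hdim3 hzd g₀ hg₀ hdiv O₁ hOO₁ hne hO₁ B hBO hAB hBfg hBreg hBdim hBdim₁ hreg₁ c hc h2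
  classical
  haveI : Fact p.Prime := ⟨hp⟩
  haveI := hfrac
  have hBO₁ : B.toSubring ≤ O₁.toSubring := fun w hw => hOO₁ (hBO hw)
  obtain ⟨u, hu, hGu, hres⟩ := h2
  -- S3: the centre curve made regular
  obtain ⟨B', hB'O, hBB', hB'fg, hB'reg, hB'dim, hloc₁, x, y, z, hx, hy, hz, hmax, hcen⟩ :=
    hS3 k K O A hAO hAfg hfrac hdimA hzd B hBO hAB hBfg hBreg hBdim O₁ hOO₁ hBdim₁
  haveI := isLocalRing_locAtCentre hB'O
  haveI : IsRegularLocalRing ↥(locAtCentre B'.toSubring O) := hB'reg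
  have hB'O₁ : B'.toSubring ≤ O₁.toSubring := fun w hw => hOO₁ (hB'O hw)
  haveI := isLocalRing_locAtCentre hB'O₁
  have hR₁O₁ : locAtCentre B'.toSubring O₁ ≤ O₁.toSubring := locAtCentre_le hB'O₁
  have hinv : ∀ {r : K}, r ∈ locAtCentre B'.toSubring O₁ → O₁.valuation r = 1 → r⁻¹ ∈ locAtCentre B'.toSubring O₁ :=
    fun hr hv => inv_mem_locAtCentre hr hv
  have hS'S₁ : locAtCentre B'.toSubring O ≤ locAtCentre B'.toSubring O₁ := le_locAtCentre_coarse hOO₁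
  have hdimR₁ : ringKrullDim ↥(locAtCentre B'.toSubring O₁) = 2 := by rw [hloc₁]; exact hBdim₁
  obtain ⟨hvz₁, hvx₁, hvy₁⟩ := valuation_coarse_z_eq_one hB'O hOO₁ hB'dim hx hy hz hmax hcen
  have hz0 : z ≠ 0 := ne_zero_of_valuation_eq_one hvz₁
  -- the unit `u = a / b` and `w = b^p u ∈ B'`
  have huS₁ : (u : K) ∈ locAtCentre B'.toSubring O₁ := by rw [hloc₁]; exact u.2
  obtain ⟨a, haB', b, hbB', hvb, hab⟩ := mem_locAtCentre_iff.mp huS₁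
  have hb0 : b ≠ 0 := ne_zero_of_valuation_eq_one hvb
  have hu1 : O₁.valuation (u : K) = 1 := (isUnit_locAtCentre_iff hBO₁ u).mp hu
  set w : K := b ^ p * (u : K) with hwdef
  have hw_eq : w = a * b ^ (p - 1) := by
    obtain ⟨q, hq⟩ : ∃ q, p = q + 1 := ⟨p - 1, (Nat.sub_add_cancel hp.one_lt.le).symm⟩
    rw [hwdef, hab, hq, Nat.add_sub_cancel, pow_succ]; field_simp
  have hwB' : w ∈ B' := by rw [hw_eq]; exact B'.mul_mem haB' (B'.pow_mem hbB' _)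
  have hwS' : w ∈ locAtCentre B'.toSubring O := le_locAtCentre _ _ hwB'
  have hvw : O₁.valuation w = 1 := by rw [hwdef, map_mul, map_pow, hvb, one_pow, one_mul, hu1]
  -- the residue field `L = κ(R₁)`, the residue valuation ring `V̄`, and `w̄`
  obtain ⟨V, hV₁, hV₂⟩ := exists_residueValuationSubring (O := O) hR₁O₁ hinv
  have hdef : IsDefectlessField (ResidueField ↥(locAtCentre B'.toSubring O₁)) V :=
    isDefectlessField_residueVal O A hzd B' hB'O (hAB.trans hBB') hB'fg hB'dim O₁ hOO₁ rfl hdimR₁ V hV₁ hV₂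
  haveI : CharP (ResidueField ↥(locAtCentre B'.toSubring O₁)) p := by
    letI : Algebra k ↥B'.toSubring := inferInstanceAs (Algebra k ↥B')
    let f : k →+* ResidueField ↥(locAtCentre B'.toSubring O₁) :=
      (residue ↥(locAtCentre B'.toSubring O₁)).comp ((Subring.inclusion (le_locAtCentre B'.toSubring O₁)).comp (algebraMap k ↥B'.toSubring))
    exact charP_of_injective_ringHom f.injective p
  set wbar := residue ↥(locAtCentre B'.toSubring O₁) ⟨w, hS'S₁ hwS'⟩ with hwbar
  have hwbar_np : ∀ ξ : ResidueField ↥(locAtCentre B'.toSubring O₁), ξ ^ p ≠ wbar := by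
    intro ξ hξ
    obtain ⟨r, rfl⟩ := residue_surjective ξ
    have h0 : residue ↥(locAtCentre B'.toSubring O₁) (r ^ p - ⟨w, hS'S₁ hwS'⟩) = 0 := by rw [map_sub, map_pow, hξ, sub_self]
    have hlt : O₁.valuation ((r : K) ^ p - w) < 1 := (residue_eq_zero_iff_coarse hR₁O₁ hinv _).mp h0
    -- the competitor `r / b ∈ locAtCentre B O₁`
    have hc'' : (r : K) * b⁻¹ ∈ locAtCentre B.toSubring O₁ := by
      rw [← hloc₁]; exact Subring.mul_mem _ r.2 (hinv (le_locAtCentre _ _ hbB') hvb)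
    apply hres ⟨_, hc''⟩
    rw [mem_maximalIdeal_locAtCentre_iff hBO₁]
    change O₁.valuation ((u : K) - ((r : K) * b⁻¹) ^ p) < 1
    have hcalc : (u : K) - ((r : K) * b⁻¹) ^ p = -(((r : K) ^ p - w) / b ^ p) := by
      have hbp : (b : K) ^ p ≠ 0 := pow_ne_zero _ hb0
      have h1 : ((r : K) * b⁻¹) ^ p = (r : K) ^ p / b ^ p := by rw [mul_pow, inv_pow, div_eq_mul_inv]
      have h2 : -(((r : K) ^ p - w) / b ^ p) = w / b ^ p - (r : K) ^ p / b ^ p := by rw [sub_div]; ring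
      have h3 : w / b ^ p = (u : K) := by rw [hwdef, mul_comm, mul_div_assoc, div_self hbp, mul_one]
      rw [h1, h2, h3]
    rw [hcalc, Valuation.map_neg, map_div₀, map_pow, hvb, one_pow, div_one]
    exact hlt
  obtain ⟨f₀, hbest⟩ := exists_isMin_pthPowerApprox_of_isDefectlessField V hdef wbar hwbar_np
  have hwbarV : wbar ∈ V := hV₁ _ (hB'O hwB')
  have hf₀V : f₀ ∈ V := best_approx_mem p V hwbarV hbest
  obtain ⟨r₀, hr₀O, hr₀⟩ := hV₂ f₀ hf₀V
  obtain ⟨c₀, hc₀S', hc₀r₀⟩ := exists_mem_residue_eq hB'O hOO₁ hB'dim hx hy hz hmax hcen r₀.2 hr₀O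
  have hres_c₀ : residue ↥(locAtCentre B'.toSubring O₁) ⟨c₀, hS'S₁ hc₀S'⟩ = f₀ := by
    rw [← hr₀, ← sub_eq_zero, ← map_sub]
    exact (residue_eq_zero_iff_coarse hR₁O₁ hinv _).mpr hc₀r₀
  -- `δ = w - c₀^p ∈ S'` is an `O₁`-unit: decompose it off the curve
  set δ : K := w - c₀ ^ p with hδ
  have hδS' : δ ∈ locAtCentre B'.toSubring O := Subring.sub_mem _ hwS' (Subring.pow_mem _ hc₀S' _)
  have hresδ : residue ↥(locAtCentre B'.toSubring O₁) ⟨δ, hS'S₁ hδS'⟩ = wbar - f₀ ^ p := by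
    rw [← hres_c₀, ← map_pow, ← map_sub]; rfl
  have hvδ : O₁.valuation δ = 1 := by
    apply (residue_ne_zero_iff_coarse hR₁O₁ hinv ⟨δ, hS'S₁ hδS'⟩).mp
    rw [hresδ, sub_ne_zero]; exact fun h => hwbar_np f₀ h.symm
  obtain ⟨m, U, α, β, hU, hα, hβ, hvU, hδeq⟩ := exists_eq_unit_mul_pow_add_K hB'O hOO₁ hB'dim hx hy hz hmax hcen hδS' hvδ
  -- residues: `w̄ - f₀^p = z̄^m · Ū`
  have hUR₁ : U ∈ locAtCentre B'.toSubring O₁ := hS'S₁ hU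
  have hzR₁ : z ∈ locAtCentre B'.toSubring O₁ := hS'S₁ hz
  have hUO : U ∈ O := locAtCentre_le hB'O hU
  have hresδ' : wbar - f₀ ^ p = residue ↥(locAtCentre B'.toSubring O₁) ⟨z, hzR₁⟩ ^ m * residue ↥(locAtCentre B'.toSubring O₁) ⟨U, hUR₁⟩ := by
    rw [← hresδ, ← map_pow, ← map_mul, ← sub_eq_zero, ← map_sub]
    apply (residue_eq_zero_iff_coarse hR₁O₁ hinv _).mpr
    change O₁.valuation (δ - z ^ m * U) < 1
    rw [hδeq, show U * z ^ m + x * α + y * β - z ^ m * U = x * α + y * β by ring]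
    exact lt_of_le_of_lt (Valuation.map_add _ _ _) (max_lt
      (valuation_mul_lt_one_of_lt_of_mem O₁ hvx₁ (hOO₁ (locAtCentre_le hB'O hα)))
      (valuation_mul_lt_one_of_lt_of_mem O₁ hvy₁ (hOO₁ (locAtCentre_le hB'O hβ))))
  have hzbar0 : residue ↥(locAtCentre B'.toSubring O₁) ⟨z, hzR₁⟩ ≠ 0 := (residue_ne_zero_iff_coarse hR₁O₁ hinv ⟨z, hzR₁⟩).mpr hvz₁
  have hUbarV : residue ↥(locAtCentre B'.toSubring O₁) ⟨U, hUR₁⟩ ∈ V := hV₁ _ hUO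
  have hUbar1 : V.valuation (residue ↥(locAtCentre B'.toSubring O₁) ⟨U, hUR₁⟩) = 1 :=
    (residueVal_eq_one_iff hOO₁ hR₁O₁ hinv V hV₁ hV₂ ⟨U, hUR₁⟩ (Shannon.valuation_eq_one_of_le hOO₁ hvU)).mpr hvU
  have hdich := dichotomy_of_best_approx p V hzbar0 hUbarV hUbar1 hresδ' hbest
  -- point blow-ups, inside `R₁`
  obtain ⟨B'', hB''O, hAB'', hB''fg, hB''reg, hB''dim, hSS, hS''R₁, h₁, h₂, h₃, hmax''⟩ :=
    pointPrep_weak_le k K O A hAO hAfg hfrac hdimA hzd B' hB'O (hAB.trans hBB') hB'fg hB'reg hB'dim O₁ hOO₁ x y z hx hy hz hmax hcen (m + 1)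
  haveI := isLocalRing_locAtCentre hB''O
  haveI : IsRegularLocalRing ↥(locAtCentre B''.toSubring O) := hB''reg
  -- the unit upstairs `U₂ = U + z (x' α + y' β)`, `δ = z^m U₂`
  set U₂ : K := U + z * (x / z ^ (m + 1) * α + y / z ^ (m + 1) * β) with hU₂
  have hU₂mem : U₂ ∈ locAtCentre B''.toSubring O :=
    Subring.add_mem _ (hSS hU) (Subring.mul_mem _ h₃ (Subring.add_mem _ (Subring.mul_mem _ h₁ (hSS hα)) (Subring.mul_mem _ h₂ (hSS hβ))))
  have hvz : O.valuation z < 1 := (valuation_lt_one_of_gen hB'O hx hy hz hmax).2.2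
  have hvm₂ : O₁.valuation (z * (x / z ^ (m + 1) * α + y / z ^ (m + 1) * β)) < 1 := by
    have hvzm : ∀ n : ℕ, O₁.valuation (z ^ n) = 1 := fun n => by rw [map_pow, hvz₁, one_pow]
    have hx' : O₁.valuation (x / z ^ (m + 1)) < 1 := by rw [map_div₀, hvzm, div_one]; exact hvx₁
    have hy' : O₁.valuation (y / z ^ (m + 1)) < 1 := by rw [map_div₀, hvzm, div_one]; exact hvy₁
    rw [mul_comm]
    refine valuation_mul_lt_one_of_lt_of_mem O₁ ?_ (hOO₁ (locAtCentre_le hB'O hz))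
    exact lt_of_le_of_lt (Valuation.map_add _ _ _) (max_lt
      (valuation_mul_lt_one_of_lt_of_mem O₁ hx' (hOO₁ (locAtCentre_le hB'O hα)))
      (valuation_mul_lt_one_of_lt_of_mem O₁ hy' (hOO₁ (locAtCentre_le hB'O hβ))))
  have hvU₂ : O.valuation U₂ = 1 := by
    rw [hU₂]; exact valuation_add_eq_one_of_lt O hvU (valuation_lt_of_lt_of_le hOO₁ (lt_of_lt_of_le hvm₂ (le_of_eq (Valuation.map_one _).symm)))
  have hU₂unit : IsUnit (⟨U₂, hU₂mem⟩ : ↥(locAtCentre B''.toSubring O)) := isUnit_locAtCentre_of_valuation_eq_one hB''O hU₂mem hvU₂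
  have hkey : w - c₀ ^ p = U₂ * z ^ m := by
    change δ = _; rw [hδeq, hU₂]; field_simp; ring
  -- the new representative `c'`: `Σ c'_j^p g₀^j = w - c₀^p`
  haveI : CharP K p := charP_of_injective_algebraMap (algebraMap k K).injective p
  let c' : Fin p → K := fun j => if (j : ℕ) = 0 then c j * b - c₀ else c j * b
  have hc'ne : ∃ j : Fin p, (j : ℕ) ≠ 0 ∧ c' j ≠ 0 := by
    obtain ⟨j₀, hj₀, hcj₀⟩ := hc
    refine ⟨j₀, hj₀, ?_⟩
    simp only [c', if_neg hj₀]
    exact mul_ne_zero hcj₀ hb0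
  have hsum : (∑ j : Fin p, c' j ^ p * g₀ ^ (j : ℕ)) = w - c₀ ^ p := by
    have h0 : (⟨0, hp.pos⟩ : Fin p) ∈ (Finset.univ : Finset (Fin p)) := Finset.mem_univ _
    have hwsum : w = ∑ j : Fin p, (c j * b) ^ p * g₀ ^ (j : ℕ) := by
      rw [hwdef, ← hGu, Finset.mul_sum]
      refine Finset.sum_congr rfl fun j _ => ?_
      rw [mul_pow]; ring
    rw [hwsum, ← Finset.add_sum_erase _ _ h0, ← Finset.add_sum_erase _ (fun j => (c j * b) ^ p * g₀ ^ (j : ℕ)) h0]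
    have hrest : ∑ j ∈ Finset.univ.erase (⟨0, hp.pos⟩ : Fin p), c' j ^ p * g₀ ^ (j : ℕ) =
        ∑ j ∈ Finset.univ.erase (⟨0, hp.pos⟩ : Fin p), (c j * b) ^ p * g₀ ^ (j : ℕ) := by
      refine Finset.sum_congr rfl fun j hj => ?_
      have hj0 : (j : ℕ) ≠ 0 := fun h => (Finset.ne_of_mem_erase hj) (Fin.ext h)
      simp only [c', if_neg hj0]
    rw [hrest]
    simp only [c', if_true, pow_zero, mul_one]
    rw [sub_pow_char (p := p) (c ⟨0, hp.pos⟩ * b) c₀]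
    ring
  by_cases hpm : p ∣ m
  · /- `p ∣ m` ⇒ the residue of `U` is not a `p`-th power: rescale by `z^{-m}`, FORM (2) with the unit `U₂` upstairs -/
    have hunit : ∀ e ∈ V, V.valuation (residue ↥(locAtCentre B'.toSubring O₁) ⟨U, hUR₁⟩ - e ^ p) = 1 :=
      hdich.resolve_left (not_not.mpr hpm)
    obtain ⟨j, hj⟩ := hpm
    have hzj0 : z ^ j ≠ 0 := pow_ne_zero _ hz0
    let c'' : Fin p → K := fun i => c' i * (z ^ j)⁻¹
    have hc''ne : ∃ i : Fin p, (i : ℕ) ≠ 0 ∧ c'' i ≠ 0 := exists_ne_zero_mul_of_exists hc'ne (inv_ne_zero hzj0)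
    have hsum'' : (∑ i : Fin p, c'' i ^ p * g₀ ^ (i : ℕ)) = U₂ := by
      change (∑ i : Fin p, (c' i * (z ^ j)⁻¹) ^ p * g₀ ^ (i : ℕ)) = U₂
      rw [sum_mul_pow_rescale, hsum, hkey, hj, pow_mul, inv_pow]
      field_simp
      rw [← pow_mul, ← pow_mul, Nat.mul_comm j p, mul_comm]
    refine ⟨B'', hB''O, hAB'', hB''fg, hB''reg, c'', hc''ne, Or.inr (Or.inl ⟨⟨U₂, hU₂mem⟩, hU₂unit, hsum'', ?_⟩)⟩
    intro c₂ hmem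
    have hlt : O.valuation (U₂ - (c₂ : K) ^ p) < 1 := (mem_maximalIdeal_locAtCentre_iff hB''O _).mp hmem
    have hc₂R₁ : (c₂ : K) ∈ locAtCentre B'.toSubring O₁ := hS''R₁ c₂.2
    have hc₂O : (c₂ : K) ∈ O := locAtCentre_le hB''O c₂.2
    have heV : residue ↥(locAtCentre B'.toSubring O₁) ⟨(c₂ : K), hc₂R₁⟩ ∈ V := hV₁ _ hc₂O
    have h1 := hunit _ heV
    rw [← map_pow, ← map_sub] at h1
    -- `U - c₂^p` versus `U₂ - c₂^p`
    have hdiffO : O.valuation (U - (c₂ : K) ^ p) < 1 := by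
      have hUU₂ : O.valuation (U - U₂) < 1 := by
        have : U - U₂ = -(z * (x / z ^ (m + 1) * α + y / z ^ (m + 1) * β)) := by rw [hU₂]; ring
        rw [this, Valuation.map_neg]
        exact valuation_lt_of_lt_of_le hOO₁ (lt_of_lt_of_le hvm₂ (le_of_eq (Valuation.map_one _).symm))
      have : U - (c₂ : K) ^ p = (U₂ - (c₂ : K) ^ p) + (U - U₂) := by ring
      rw [this]
      exact lt_of_le_of_lt (Valuation.map_add _ _ _) (max_lt hlt hUU₂)
    by_cases hcase : O₁.valuation (((⟨U, hUR₁⟩ - ⟨(c₂ : K), hc₂R₁⟩ ^ p : ↥(locAtCentre B'.toSubring O₁)) : K)) = 1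
    · have h2 := (residueVal_lt_one_iff hOO₁ hR₁O₁ hinv V hV₁ hV₂ _ hcase).mpr hdiffO
      rw [h1] at h2; exact lt_irrefl _ h2
    · have h0 : residue ↥(locAtCentre B'.toSubring O₁) (⟨U, hUR₁⟩ - ⟨(c₂ : K), hc₂R₁⟩ ^ p) = 0 := by
        by_contra hne
        exact hcase ((residue_ne_zero_iff_coarse hR₁O₁ hinv _).mp hne)
      rw [h0, map_zero] at h1
      exact zero_ne_one h1
  · /- `p ∤ m`: FORM (1) with `t = (z, x/z^n, y/z^n)`, `a = (m)` -/
    refine ⟨B'', hB''O, hAB'', hB''fg, hB''reg, c', hc'ne, Or.inl ?_⟩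
    refine ⟨3, 1, by norm_num, ![⟨z, h₃⟩, ⟨x / z ^ (m + 1), h₁⟩, ⟨y / z ^ (m + 1), h₂⟩], ![m], ⟨U₂, hU₂mem⟩, hU₂unit, ?_, hB''dim,
      Nat.one_pos, ?_, ?_⟩
    · rw [hmax'']
      congr 1
      ext v
      simp only [Set.mem_range, Set.mem_insert_iff, Set.mem_singleton_iff]
      constructor
      · rintro ⟨j, rfl⟩; fin_cases j <;> simp
      · rintro (rfl | rfl | rfl); exacts [⟨1, rfl⟩, ⟨2, rfl⟩, ⟨0, rfl⟩]
    · intro j; fin_cases j; exact hpm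
    · rw [hsum, hkey, Fin.prod_univ_one]
      rfl

end Summit.ResolutionOfSingularities.ResolutionOfSingularities.Theorems.RadicialJung.CleanModels.Ccurve

end
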